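import Literature.Geometry.Lorentzian.CoordConjugateHeat
import Literature.Geometry.Lorentzian.CoordFormCauchySchwarz
import Literature.Geometry.Lorentzian.CoordPairingDerivQuadratic
import Literature.Geometry.Riemannian.GradientSolitonIdentities
import HarnessLib

/-!
# Munteanu–Wang 2015, Lemma 1.2 / Prop. 1.3 at a point: the drift Laplacian of
# `u = |Ric|² (S + 1)^{-1/2}` on a gradient shrinker, in coordinates

Pointwise coordinate computation (metric components `G : E → (E →L E →L ℝ)` on an open `V`,
`MetricCoord.IsMetricOn G V`, positive definite at the point `x`; `Ric + Hess f = ½ G` on `V`) behind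
**Munteanu–Wang 2015, Prop. 1.3** ("`sup |Ric|²/S ≤ C` on a four dimensional shrinking gradient Ricci
soliton with `S ≤ A`"), in the variant with the profile `(S + 1)^{-1/2}` instead of `S^{-a}` (so that no
lower bound for `S` is needed) which gives the boundedness of `|Ric|`:

* `IsMetricOn.apply_sharpAt_sq_le` — Cauchy–Schwarz for covectors, `(α(♯β))² ≤ α(♯α) β(♯β)`;
* `IsMetricOn.fderiv_normSqAt_ricAt`, `IsMetricOn.contDiffAt_normSqAt_ricAt` — `d|Ric|² = 2⟨Ric, ∇Ric⟩`,
  smoothness of `|Ric|²`; `IsMetricOn.gradSqAt_normSqAt_ricAt_le` — **the Kato inequality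
  `|∇|Ric|²|² ≤ 4|Ric|²|∇Ric|²`** (`|∇Ric|² = Σ g^{kl}⟨∇_{b_k}Ric, ∇_{b_l}Ric⟩`);
* `IsMetricOn.lapAt_sub_fderiv_mul_comp` — the expansion of `Δ(Rφ(S)) − d(Rφ(S))(W)` (product rule
  `lapAt_mul`, local chain rule `lapAt_comp_of_contDiffAt`), i.e. Munteanu–Wang's (1.11);
* `hasDerivAt_profile`, `deriv_profile`, `deriv_deriv_profile`, `contDiffAt_profile` — the profile
  `t ↦ (t+1)^p` near `t + 1 > 0`;
* `mw_sqrt_term_bound`, `mw_drift_arith`, `mw_constants` — the real arithmetic of the proof of Lemma 1.2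
  and Prop. 1.3 (weighted AM–GM absorptions with explicit constants);
* `IsMetricOn.mw_drift_normSqAt_ricAt_mul_profile` — **the pointwise drift inequality**: GIVEN at `x`
  (i) `|∇f|²|Rm|² ≤ 16|∇f|²|Ric|² + 64|∇Ric|²` (Prop. 1.1, file `CoordShrinkerCurvatureGradientBound`)
  and (ii) `Δ_f|Ric|² ≥ 2|∇Ric|² + 2|Ric|² − 4|Rm||Ric|²` ((1.10), file `CoordShrinkerRicciNormSqDrift`),
  and `0 ≤ S ≤ A`, `|∇f|² ≥ 768(A+1)`: for `u = |Ric|²(S+1)^{-1/2}`,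
  `Δ_G u − du(∇f) ≥ u²/(8√(A+1)) − 2¹⁷(A+1)³` (the cross term `⟨∇(S+1)^{-1/2}, ∇|Ric|²⟩` is absorbed
  by Kato + Cauchy–Schwarz against `φ''|∇S|²`, the `|Rm|` term by Prop. 1.1 against `2|∇Ric|²` and
  the good term `|Ric|⁴(S+1)^{-3/2}` coming from `Δ_f S = S − 2|Ric|²`, `IsMetricOn.lapAt_scalAt_of_soliton`).
  The two inputs are taken as hypotheses here (they are proved in the sibling files) so that this
  file only depends on the coordinate calculus already in the tree.

First user: the boundedness of `|Ric|` on complete four-dimensional gradient shrinkers with bounded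
scalar curvature (Munteanu–Wang 2015, Prop. 1.3 / Thm. 1.4), step 1 of the printed chain behind the
named fact `shrinkerSplittingAtInfinity_four` (crux `EntropyRung.NoncompactShrinkerGap`,
SmoothPoincare4). Everything is proved; no definition and no statement of `Prop` type is introduced.

## References

* O. Munteanu, J. Wang, *Geometry of shrinking Ricci solitons*, Compositio Math. 151 (2015)
  2273–2300 = arXiv:1410.3813, §1: Prop. 1.1 (p. 4), Lemma 1.2 with (1.10)–(1.11) (p. 5), Prop. 1.3
  and its proof (pp. 5–6). READ (arXiv text). [MunteanuWang2015]
* R. S. Hamilton, *Three-manifolds with positive Ricci curvature*, J. Differential Geom. 17 (1982),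
  §7 (`d|T|² = 2⟨T, ∇T⟩`). [Hamilton1982]
* B. O'Neill, *Semi-Riemannian geometry with applications to relativity*, Academic Press 1983, Ch. 3,
  pp. 60–61, Def. 3.50. [ONeill1983]
-/

noncomputable section

set_option maxSynthPendingDepth 3

open Set Filter ContinuousLinearMap Module
open scoped Topology ContDiff

namespace Literature.Geometry.Lorentzian

namespace MetricCoord

variable {E : Type*} [NormedAddCommGroup E] [NormedSpace ℝ E] [FiniteDimensional ℝ E]
  {G : E → E →L[ℝ] E →L[ℝ] ℝ} {V : Set E} {x : E}

/-! ### Cauchy–Schwarz for covectors and the Kato inequality for `|Ric|²` -/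

/-- **Cauchy–Schwarz for the inverse metric on covectors** at a positive definite point:
`(α(♯β))² ≤ α(♯α) β(♯β)` (in an orthonormal frame `α(♯β) = Σ_c α(e_c) β(e_c)`). [folklore] -/
theorem IsMetricOn.apply_sharpAt_sq_le (hG : IsMetricOn G V) (hx : x ∈ V)
    (hpos : ∀ v : E, v ≠ 0 → 0 < G x v v) (α β : E →L[ℝ] ℝ) :
    (α (sharpAt G x β)) ^ 2 ≤ α (sharpAt G x α) * β (sharpAt G x β) := by
  have hi := hG.isInvertible x hx
  have hs := hG.symm x hx
  obtain ⟨e, he⟩ := exists_orthonormal_basis hs hpos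
  rw [apply_sharpAt_eq_sum_frame e he hi hs, apply_sharpAt_eq_sum_frame e he hi hs,
    apply_sharpAt_eq_sum_frame e he hi hs]
  calc (∑ c, β (e c) * α (e c)) ^ 2 ≤ (∑ c, β (e c) ^ 2) * ∑ c, α (e c) ^ 2 :=
        Finset.sum_mul_sq_le_sq_mul_sq _ _ _
    _ = (∑ c, α (e c) * α (e c)) * ∑ c, β (e c) * β (e c) := by
        rw [mul_comm]
        simp only [sq]

variable [CompleteSpace E]

/-- `|Ric|²` agrees near `x ∈ V` with the pairing `⟨Ric, Ric⟩` (the Ricci form is symmetric on `V`).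
[folklore] -/
theorem IsMetricOn.normSqAt_ricAt_eventuallyEq_pairAt (hG : IsMetricOn G V) (hx : x ∈ V) :
    (fun y ↦ normSqAt G y (ricAt G y)) =ᶠ[𝓝 x] fun y ↦ pairAt G y (ricAt G y) (ricAt G y) := by
  filter_upwards [hG.mem_nhds hx] with y hy
  exact (pairAt_self_of_symm G y (hG.ricAt_comm hy)).symm

/-- **`d|Ric|²(Y) = 2⟨Ric, ∇_Y Ric⟩`.** [cite: Hamilton1982, §7] -/
theorem IsMetricOn.fderiv_normSqAt_ricAt (hG : IsMetricOn G V) (hx : x ∈ V) (Y : E) :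
    fderiv ℝ (fun y ↦ normSqAt G y (ricAt G y)) x Y =
      2 * pairAt G x (ricAt G x) (cov₂At G (ricAt G) x Y) := by
  have hRd := hG.differentiableAt_ricAt hx
  rw [(hG.normSqAt_ricAt_eventuallyEq_pairAt hx).fderiv_eq, hG.fderiv_pairAt hx hRd hRd Y,
    pairAt_comm G x (cov₂At G (ricAt G) x Y) (ricAt G x)]
  ring

/-- `|Ric|²` is `C^∞` at the points of `V`. [folklore] -/
theorem IsMetricOn.contDiffAt_normSqAt_ricAt (hG : IsMetricOn G V) (hx : x ∈ V) :
    ContDiffAt ℝ ∞ (fun y ↦ normSqAt G y (ricAt G y)) x := by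
  have hq := hG.contDiffOn_quadratic (c := 0) hG.contDiffOn_ricAt
  have h2 : ContDiffAt ℝ ∞ (fun y ↦ (-2 : ℝ) * (1 / 2 * (0 * mtrAt G y (ricAt G y) ^ 2
      - pairAt G y (ricAt G y) (ricAt G y)))) x :=
    contDiffAt_const.mul ((hq x hx).contDiffAt (hG.mem_nhds hx))
  refine h2.congr_of_eventuallyEq ?_
  filter_upwards [hG.normSqAt_ricAt_eventuallyEq_pairAt hx] with y hy
  rw [hy]
  ring

/-- **The Kato inequality for `|Ric|²`**: `|∇|Ric|²|² ≤ 4 |Ric|² |∇Ric|²` at a positive definite point,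
with `|∇Ric|² = Σ g^{kl}⟨∇_{b_k}Ric, ∇_{b_l}Ric⟩` (any basis `b`): `d|Ric|² = 2⟨Ric, ∇Ric⟩` and
Cauchy–Schwarz twice. [cite: MunteanuWang2015, Lemma 1.2 (proof)] -/
theorem IsMetricOn.gradSqAt_normSqAt_ricAt_le (hG : IsMetricOn G V) (hx : x ∈ V)
    (hpos : ∀ v : E, v ≠ 0 → 0 < G x v v) {ι : Type*} [Fintype ι] (b : Basis ι ℝ E) :
    gradSqAt G (fun y ↦ normSqAt G y (ricAt G y)) x ≤
      4 * normSqAt G x (ricAt G x) *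
        ∑ k, ∑ l, ginv G b x k l * pairAt G x (cov₂At G (ricAt G) x (b k)) (cov₂At G (ricAt G) x (b l)) := by
  set φ : E →L[ℝ] ℝ := fderiv ℝ (fun y ↦ normSqAt G y (ricAt G y)) x with hφ
  set D := ∑ k, ∑ l, ginv G b x k l *
    pairAt G x (cov₂At G (ricAt G) x (b k)) (cov₂At G (ricAt G) x (b l)) with hD
  set Rc := normSqAt G x (ricAt G x) with hRc
  have hsymV : ∀ y ∈ V, ∀ v w, ricAt G y v w = ricAt G y w v := fun y hy ↦ hG.ricAt_comm hy
  have hRic : ∀ v w, ricAt G x v w = ricAt G x w v := hsymV x hx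
  have hcov : ∀ v w, cov₂At G (ricAt G) x (sharpAt G x φ) v w = cov₂At G (ricAt G) x (sharpAt G x φ) w v :=
    hG.cov₂At_symm_of_symmOn hx hG.contDiffOn_ricAt hsymV (sharpAt G x φ)
  have hD0 : 0 ≤ D := hG.covNormSq_nonneg b hx hpos hG.contDiffOn_ricAt hsymV
  have hRc0 : 0 ≤ Rc := hG.normSqAt_nonneg_of_symm hx hpos hRic
  -- `X = |∇|Ric|²|² = φ(♯φ) = 2⟨Ric, ∇_{♯φ}Ric⟩`
  set X := gradSqAt G (fun y ↦ normSqAt G y (ricAt G y)) x with hX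
  have hX0 : 0 ≤ X := by
    rw [hX, gradSqAt_apply]
    exact apply_sharpAt_self_nonneg (hG.isInvertible x hx) (fun v ↦ by
      by_cases hv : v = 0
      · simp [hv]
      · exact (hpos v hv).le) _
  have hXeq : X = 2 * pairAt G x (ricAt G x) (cov₂At G (ricAt G) x (sharpAt G x φ)) := by
    rw [hX, gradSqAt_apply, ← hφ, hG.fderiv_normSqAt_ricAt hx]
  -- Cauchy–Schwarz: `⟨Ric, ∇_{♯φ}Ric⟩² ≤ |Ric|² |∇_{♯φ}Ric|² ≤ |Ric|² |∇Ric|² φ(♯φ)`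
  have hCS := hG.pairAt_sq_le hx hpos hRic hcov
  have hK := hG.normSqAt_cov₂At_sharpAt_le b hx hpos hG.contDiffOn_ricAt hsymV φ
  have hφφ : φ (sharpAt G x φ) = X := by rw [hX, gradSqAt_apply]
  rw [hφφ] at hK
  -- `X² = 4⟨Ric,∇_{♯φ}Ric⟩² ≤ 4 Rc D X`, hence `X ≤ 4 Rc D`
  have hsq : X ^ 2 ≤ 4 * Rc * D * X := by
    calc X ^ 2 = 4 * pairAt G x (ricAt G x) (cov₂At G (ricAt G) x (sharpAt G x φ)) ^ 2 := by
          rw [hXeq]; ring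
      _ ≤ 4 * (Rc * normSqAt G x (cov₂At G (ricAt G) x (sharpAt G x φ))) := by
          have := hCS; nlinarith
      _ ≤ 4 * (Rc * (D * X)) := by
          have h := mul_le_mul_of_nonneg_left hK hRc0
          linarith
      _ = 4 * Rc * D * X := by ring
  rcases hX0.lt_or_eq with hXpos | hX0'
  · exact le_of_mul_le_mul_right (by nlinarith [hsq]) hXpos
  · rw [← hX0']
    positivity

/-! ### The drift Laplacian of a product `R · φ(S)` -/

omit [CompleteSpace E] in
/-- **`Δ(R φ(S)) − D(R φ(S))(W)` expanded**: for `R`, `S` of class `C²` at `x ∈ V` and a profile `φ`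
of class `C²` at `S x`,
`Δ_G(Rφ(S)) − d(Rφ(S))(W) = φ(S)(Δ_G R − dR(W)) + R (φ'(S)(Δ_G S − dS(W)) + φ''(S)|∇S|²) + 2φ'(S)⟨∇R, ∇S⟩`
(product rule `lapAt_mul`, chain rule `lapAt_comp_of_contDiffAt`). With `W = ∇f` this is the
expansion of `Δ_f(|Ric|² S^{-a})` in Munteanu–Wang 2015, (1.11). [cite: MunteanuWang2015, Lemma 1.2 (proof, (1.11))] -/
theorem IsMetricOn.lapAt_sub_fderiv_mul_comp (hG : IsMetricOn G V) (hx : x ∈ V) {R S : E → ℝ}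
    (hR : ContDiffAt ℝ 2 R x) (hS : ContDiffAt ℝ 2 S x) {φ : ℝ → ℝ} (hφ : ContDiffAt ℝ 2 φ (S x))
    (W : E) :
    lapAt G (fun y ↦ R y * φ (S y)) x - fderiv ℝ (fun y ↦ R y * φ (S y)) x W =
      φ (S x) * (lapAt G R x - fderiv ℝ R x W)
        + R x * (deriv φ (S x) * (lapAt G S x - fderiv ℝ S x W)
          + deriv (deriv φ) (S x) * gradSqAt G S x)
        + 2 * deriv φ (S x) * fderiv ℝ R x (sharpAt G x (fderiv ℝ S x)) := by
  have hi := hG.isInvertible x hx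
  have hs := hG.symm x hx
  have hψ : ContDiffAt ℝ 2 (fun y ↦ φ (S y)) x := hφ.comp x hS
  have hRd : DifferentiableAt ℝ R x := hR.differentiableAt (by simp)
  have hSd : DifferentiableAt ℝ S x := hS.differentiableAt (by simp)
  have hφd : DifferentiableAt ℝ φ (S x) := hφ.differentiableAt (by simp)
  have hψd : DifferentiableAt ℝ (fun y ↦ φ (S y)) x := hψ.differentiableAt (by simp)
  -- product and chain rules
  rw [lapAt_mul G hi hs hR hψ, lapAt_comp_of_contDiffAt hφ hS, fderiv_fun_mul hRd hψd,
    fderiv_comp_eq_of_differentiableAt hφd hSd]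
  simp only [_root_.add_apply, FunLike.coe_smul, Pi.smul_apply, smul_eq_mul, map_smul]
  ring

/-! ### The profile `t ↦ (t + 1)^p` near a point with `t + 1 > 0` -/

omit [CompleteSpace E] in
/-- `d/ds (s+1)^p = p (t+1)^{p-1}` at `t` with `t + 1 > 0`. [folklore] -/
theorem hasDerivAt_profile (p : ℝ) {t : ℝ} (ht : 0 < t + 1) :
    HasDerivAt (fun s : ℝ ↦ (s + 1) ^ p) (p * (t + 1) ^ (p - 1)) t := by
  have h := ((hasDerivAt_id' t).add_const 1).rpow_const (p := p) (Or.inl ht.ne')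
  convert h using 1
  ring

omit [CompleteSpace E] in
/-- `deriv (s ↦ (s+1)^p) t = p (t+1)^{p-1}` for `t + 1 > 0`. [folklore] -/
theorem deriv_profile (p : ℝ) {t : ℝ} (ht : 0 < t + 1) :
    deriv (fun s : ℝ ↦ (s + 1) ^ p) t = p * (t + 1) ^ (p - 1) :=
  (hasDerivAt_profile p ht).deriv

omit [CompleteSpace E] in
/-- The second derivative `p (p − 1) (t+1)^{p-2}` of the profile at `t` with `t + 1 > 0`. [folklore] -/
theorem deriv_deriv_profile (p : ℝ) {t : ℝ} (ht : 0 < t + 1) :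
    deriv (deriv fun s : ℝ ↦ (s + 1) ^ p) t = p * (p - 1) * (t + 1) ^ (p - 2) := by
  have hev : deriv (fun s : ℝ ↦ (s + 1) ^ p) =ᶠ[𝓝 t] fun s ↦ p * (s + 1) ^ (p - 1) := by
    have hopen : ∀ᶠ s in 𝓝 t, 0 < s + 1 :=
      (continuous_id.add continuous_const).continuousAt.eventually (lt_mem_nhds ht)
    filter_upwards [hopen] with s hs
    exact deriv_profile p hs
  rw [hev.deriv_eq]
  have h := ((hasDerivAt_profile (p - 1) ht).const_mul p).deriv
  rw [h]
  rw [show p - 1 - 1 = p - 2 by ring]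
  ring

omit [CompleteSpace E] in
/-- The profile is `C²` (indeed `C^∞`) at `t` with `t + 1 > 0`. [folklore] -/
theorem contDiffAt_profile (p : ℝ) {t : ℝ} (ht : 0 < t + 1) :
    ContDiffAt ℝ 2 (fun s : ℝ ↦ (s + 1) ^ p) t :=
  (contDiffAt_id.add contDiffAt_const).rpow_const_of_ne ht.ne'

/-! ### Real-variable lemmas (the arithmetic of Munteanu–Wang's Lemma 1.2 / Prop. 1.3) -/

section Real

omit [CompleteSpace E]

/-- `y² ≤ 4ab`, `a, b ≥ 0` ⇒ `y ≤ ¾ a + (4/3) b` (weighted AM–GM). [folklore] -/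
theorem le_of_sq_le_four_mul {y a b : ℝ} (ha : 0 ≤ a) (hb : 0 ≤ b) (h : y ^ 2 ≤ 4 * a * b) :
    y ≤ 3 / 4 * a + 4 / 3 * b := by
  have hR : 0 ≤ 3 / 4 * a + 4 / 3 * b := by positivity
  have hsq : y ^ 2 ≤ (3 / 4 * a + 4 / 3 * b) ^ 2 := by
    nlinarith [sq_nonneg (3 / 4 * a - 4 / 3 * b)]
  exact abs_le_of_sq_le_sq' hsq hR |>.2

/-- **The `√|Rm|²` term**: from `q m² ≤ 16 q R + 64 D` (Prop. 1.1 with `m = |Rm|`, `R = |Ric|²`,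
`D = |∇Ric|²`, `q = |∇f|²`): `4 m R ≤ 16 (√R)³ + (2/3) D + 384 R²/q`. [cite: MunteanuWang2015, Lemma 1.2 (proof)] -/
theorem mw_sqrt_term_bound {R D q m : ℝ} (hR : 0 ≤ R) (hD : 0 ≤ D) (hq : 0 < q)
    (hP : q * m ^ 2 ≤ 16 * q * R + 64 * D) :
    4 * m * R ≤ 16 * Real.sqrt R ^ 3 + 2 / 3 * D + 384 * R ^ 2 / q := by
  set r : ℝ := Real.sqrt R with hrdef
  set d : ℝ := Real.sqrt D with hddef
  set pq : ℝ := Real.sqrt q with hpqdef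
  have hr0 : 0 ≤ r := Real.sqrt_nonneg _
  have hd0 : 0 ≤ d := Real.sqrt_nonneg _
  have hpq0 : 0 < pq := Real.sqrt_pos.2 hq
  have hr2 : r ^ 2 = R := Real.sq_sqrt hR
  have hd2 : d ^ 2 = D := Real.sq_sqrt hD
  have hpq2 : pq ^ 2 = q := Real.sq_sqrt hq.le
  clear_value r d pq
  have hmle : m * pq ≤ 4 * r * pq + 8 * d := by
    have h1 : (m * pq) ^ 2 ≤ (4 * r * pq + 8 * d) ^ 2 := by
      have hx : (m * pq) ^ 2 = q * m ^ 2 := by rw [mul_pow, hpq2]; ring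
      have hy : (4 * r * pq + 8 * d) ^ 2 = 16 * q * R + 64 * D + 64 * (r * pq * d) := by
        rw [← hr2, ← hpq2, ← hd2]; ring
      rw [hx, hy]
      have hz : 0 ≤ 64 * (r * pq * d) := by positivity
      linarith [hP]
    exact abs_le_of_sq_le_sq' h1 (by positivity) |>.2
  have hkey : 32 * r ^ 2 * d * pq ≤ 2 / 3 * d ^ 2 * pq ^ 2 + 384 * (r ^ 2) ^ 2 := by
    have hid : 2 / 3 * d ^ 2 * pq ^ 2 + 384 * (r ^ 2) ^ 2 - 32 * r ^ 2 * d * pq =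
        2 / 3 * (d * pq - 24 * r ^ 2) ^ 2 := by ring
    linarith [sq_nonneg (d * pq - 24 * r ^ 2), hid]
  have hcleared : 4 * m * R * q ≤ (16 * r ^ 3 + 2 / 3 * D) * q + 384 * R ^ 2 := by
    calc 4 * m * R * q = 4 * r ^ 2 * pq * (m * pq) := by rw [← hr2, ← hpq2]; ring
      _ ≤ 4 * r ^ 2 * pq * (4 * r * pq + 8 * d) := mul_le_mul_of_nonneg_left hmle (by positivity)
      _ = 16 * r ^ 3 * pq ^ 2 + 32 * r ^ 2 * d * pq := by ring
      _ ≤ 16 * r ^ 3 * pq ^ 2 + (2 / 3 * d ^ 2 * pq ^ 2 + 384 * (r ^ 2) ^ 2) := by linarith [hkey]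
      _ = (16 * r ^ 3 + 2 / 3 * D) * q + 384 * R ^ 2 := by rw [← hr2, ← hpq2, ← hd2]; ring
  have h := div_le_div_of_nonneg_right hcleared hq.le
  rwa [mul_div_assoc, div_self hq.ne', mul_one, add_div, mul_div_assoc, div_self hq.ne', mul_one] at h

/-- **The arithmetic of Lemma 1.2 / Prop. 1.3** for `u = R c`, `c = σ^{-1/2}`: with the expanded drift
`drift = c L + R(−(c/2σ)(S − 2R) + (3c/4σ²) gS) − (c/σ) T`, the inputs `L ≥ 2D + 2R − 4mR`,
`4mR ≤ 16 (√R)³ + (2/3)D + 384 R²/q`, `T² ≤ 4 R D gS`, and `q ≥ 768 σ`, `0 ≤ S ≤ σ − 1 + 1`, one gets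
`drift ≥ (c³/8) R² − 2¹⁷/c⁵`. [cite: MunteanuWang2015, Lemma 1.2 and Prop. 1.3 (proof)] -/
theorem mw_drift_arith {c σ S R D gS T L q m drift : ℝ} (hc0 : 0 < c) (hc2 : c ^ 2 * σ = 1)
    (hσpos : 0 < σ) (hSσ : S ≤ σ) (hR0 : 0 ≤ R) (hD0 : 0 ≤ D) (hgS0 : 0 ≤ gS)
    (hq0 : 0 < q) (hqσ : 768 * σ ≤ q)
    (hL : 2 * D + 2 * R - 4 * m * R ≤ L)
    (h4mR : 4 * m * R ≤ 16 * Real.sqrt R ^ 3 + 2 / 3 * D + 384 * R ^ 2 / q)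
    (hT2 : T ^ 2 ≤ 4 * R * D * gS)
    (hdrift : drift = c * L + R * (-(1 / 2) * (c / σ) * (S - 2 * R) + 3 / 4 * (c / σ ^ 2) * gS)
      + 2 * (-(1 / 2) * (c / σ)) * T) :
    c ^ 3 * R ^ 2 / 8 - 131072 / c ^ 5 ≤ drift := by
  set r : ℝ := Real.sqrt R with hrdef
  have hr0 : 0 ≤ r := Real.sqrt_nonneg _
  have hr2 : r ^ 2 = R := Real.sq_sqrt hR0
  clear_value r
  -- the cross term `|T|/σ ≤ ¾ R gS/σ² + (4/3) D`
  have hTbound : T / σ ≤ 3 / 4 * (R * gS / σ ^ 2) + 4 / 3 * D := by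
    refine le_of_sq_le_four_mul (by positivity) hD0 ?_
    rw [div_pow, div_le_iff₀ (by positivity)]
    calc T ^ 2 ≤ 4 * R * D * gS := hT2
      _ = 4 * (R * gS / σ ^ 2) * D * σ ^ 2 := by field_simp
  have hmain : c * (2 * D + 2 * R - 4 * m * R) + c / σ * R ^ 2 - c / (2 * σ) * S * R - 4 / 3 * c * D ≤
      drift := by
    rw [hdrift]
    have hL' : c * (2 * D + 2 * R - 4 * m * R) ≤ c * L := mul_le_mul_of_nonneg_left hL hc0.le
    have hcross : -(3 / 4 * (c / σ ^ 2)) * (R * gS) - 4 / 3 * c * D ≤ 2 * (-(1 / 2) * (c / σ)) * T := by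
      have h := mul_le_mul_of_nonneg_left hTbound hc0.le
      have h1 : c * (T / σ) = -(2 * (-(1 / 2) * (c / σ)) * T) := by ring
      have h2 : c * (3 / 4 * (R * gS / σ ^ 2) + 4 / 3 * D) =
          3 / 4 * (c / σ ^ 2) * (R * gS) + 4 / 3 * c * D := by ring
      rw [h1, h2] at h
      linarith
    linear_combination hL' + hcross
  have hcσ : 1 / σ = c ^ 2 := by
    rw [div_eq_iff hσpos.ne']
    exact hc2.symm
  -- (a) insert the `√|Rm|²` bound
  have ha : 2 * c * R - 16 * c * r ^ 3 + c * R ^ 2 * (1 / σ - 384 / q) - c / (2 * σ) * S * R ≤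
      c * (2 * D + 2 * R - 4 * m * R) + c / σ * R ^ 2 - c / (2 * σ) * S * R - 4 / 3 * c * D := by
    have h := mul_le_mul_of_nonneg_left h4mR hc0.le
    have h1 : c * R ^ 2 * (1 / σ - 384 / q) = c / σ * R ^ 2 - c * (384 * R ^ 2 / q) := by ring
    have h2 : c * (16 * r ^ 3 + 2 / 3 * D + 384 * R ^ 2 / q) =
        16 * c * r ^ 3 + 2 / 3 * c * D + c * (384 * R ^ 2 / q) := by ring
    rw [h2] at h
    linarith
  -- (b) `384/q ≤ 1/(2σ)`
  have hb : c * R ^ 2 * (1 / (2 * σ)) ≤ c * R ^ 2 * (1 / σ - 384 / q) := by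
    refine mul_le_mul_of_nonneg_left ?_ (by positivity)
    have h1 : 384 / q ≤ 1 / (2 * σ) := by
      rw [div_le_div_iff₀ hq0 (by positivity)]
      linarith
    have h2 : 1 / σ = 1 / (2 * σ) + 1 / (2 * σ) := by ring
    linarith
  -- (c) `S ≤ σ`
  have hcS : c / (2 * σ) * S * R ≤ c / 2 * R := by
    have h1 : c / (2 * σ) * S * R = c / 2 * R * (S / σ) := by ring
    rw [h1]
    exact mul_le_of_le_one_right (by positivity) ((div_le_one hσpos).2 hSσ)
  -- so far: `drift ≥ (3/2) c R − 16 c r³ + c³ R²/2`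
  have hd' : c * R ^ 2 * (1 / (2 * σ)) = c ^ 3 * R ^ 2 / 2 := by
    rw [show (1 : ℝ) / (2 * σ) = 1 / 2 * (1 / σ) by ring, hcσ]; ring
  have hsofar : 3 / 2 * c * R - 16 * c * r ^ 3 + c ^ 3 * R ^ 2 / 2 ≤ drift := by
    linarith [hmain, ha, hb, hcS, hd']
  -- (d) AM–GM: `16 c r³ ≤ c³ R²/4 + 256 R/c`
  have hA1 : 16 * c * r ^ 3 ≤ c ^ 3 * R ^ 2 / 4 + 256 * R / c := by
    have hkey1 : 0 ≤ c ^ 4 * R ^ 2 + 1024 * R - 64 * c ^ 2 * r ^ 3 := by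
      have hid : c ^ 4 * R ^ 2 + 1024 * R - 64 * c ^ 2 * r ^ 3 = r ^ 2 * (c ^ 2 * r - 32) ^ 2 := by
        rw [← hr2]; ring
      rw [hid]; positivity
    rw [← sub_nonneg]
    have hid2 : c ^ 3 * R ^ 2 / 4 + 256 * R / c - 16 * c * r ^ 3 =
        (c ^ 4 * R ^ 2 + 1024 * R - 64 * c ^ 2 * r ^ 3) / (4 * c) := by
      field_simp
      ring
    rw [hid2]
    positivity
  -- (e) AM–GM: `256 R/c ≤ c³ R²/8 + 2¹⁷/c⁵`
  have hA2 : 256 * R / c ≤ c ^ 3 * R ^ 2 / 8 + 131072 / c ^ 5 := by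
    have hkey2 : 0 ≤ c ^ 8 * R ^ 2 + 1048576 - 2048 * c ^ 4 * R := by
      have hid : c ^ 8 * R ^ 2 + 1048576 - 2048 * c ^ 4 * R = (c ^ 4 * R - 1024) ^ 2 := by ring
      rw [hid]; positivity
    rw [← sub_nonneg]
    have hid2 : c ^ 3 * R ^ 2 / 8 + 131072 / c ^ 5 - 256 * R / c =
        (c ^ 8 * R ^ 2 + 1048576 - 2048 * c ^ 4 * R) / (8 * c ^ 5) := by
      field_simp
      ring
    rw [hid2]
    positivity
  have h3 : 0 ≤ 3 / 2 * c * R := by positivity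
  linarith [hsofar, hA1, hA2]

/-- **The constants**: with `c² σ = 1`, `σ ≤ A + 1`, `A ≥ 0`: `(Rc)²/(8√(A+1)) ≤ c³R²/8` and
`2¹⁷/c⁵ ≤ 2¹⁷ (A+1)³`. [cite: MunteanuWang2015, Prop. 1.3 (proof)] -/
theorem mw_constants {c σ R A : ℝ} (hc0 : 0 < c) (hc2 : c ^ 2 * σ = 1) (hσA : σ ≤ A + 1)
    (hA : 0 ≤ A) :
    (R * c) ^ 2 / (8 * Real.sqrt (A + 1)) ≤ c ^ 3 * R ^ 2 / 8 ∧
      131072 / c ^ 5 ≤ 131072 * (A + 1) ^ 3 := by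
  set t : ℝ := Real.sqrt (A + 1) with htdef
  have ht1 : 1 ≤ t := by rw [htdef, Real.one_le_sqrt]; linarith
  have ht0 : 0 < t := lt_of_lt_of_le one_pos ht1
  have ht2 : t ^ 2 = A + 1 := Real.sq_sqrt (by linarith)
  clear_value t
  have hct : 1 ≤ c * t := by
    have h1 : 1 ≤ (c * t) ^ 2 := by
      have hid : (c * t) ^ 2 = c ^ 2 * σ + c ^ 2 * (A + 1 - σ) := by rw [mul_pow, ht2]; ring
      rw [hid, hc2]
      linarith [mul_nonneg (sq_nonneg c) (sub_nonneg.2 hσA)]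
    have h2 := Real.sqrt_le_sqrt h1
    rwa [Real.sqrt_one, Real.sqrt_sq (by positivity)] at h2
  constructor
  · rw [div_le_div_iff₀ (by positivity) (by norm_num : (0 : ℝ) < 8)]
    have h1 : 0 ≤ R ^ 2 * c ^ 2 := by positivity
    have h2 := mul_le_mul_of_nonneg_left hct h1
    calc (R * c) ^ 2 * 8 = 8 * (R ^ 2 * c ^ 2 * 1) := by ring
      _ ≤ 8 * (R ^ 2 * c ^ 2 * (c * t)) := by linarith
      _ = c ^ 3 * R ^ 2 * (8 * t) := by ring
  · rw [div_le_iff₀ (by positivity)]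
    have h2 : (A + 1) ^ 3 * c ^ 5 = (c * t) ^ 5 * t := by rw [← ht2]; ring
    have h3 : 1 ≤ (c * t) ^ 5 := one_le_pow₀ hct
    have h1 : 1 ≤ (A + 1) ^ 3 * c ^ 5 := by rw [h2]; exact one_le_mul_of_one_le_of_one_le h3 ht1
    calc (131072 : ℝ) = 131072 * 1 := by ring
      _ ≤ 131072 * ((A + 1) ^ 3 * c ^ 5) := by linarith
      _ = 131072 * (A + 1) ^ 3 * c ^ 5 := by ring

end Real

/-! ### Munteanu–Wang's Lemma 1.2 / Prop. 1.3 at a point, for `u = |Ric|² (S + 1)^{-1/2}` -/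

/-- **The drift inequality for `u = |Ric|² (S+1)^{-1/2}` on a four-dimensional gradient shrinker, in
coordinates** (Munteanu–Wang 2015, Lemma 1.2 with `a = ½` and `S` replaced by `S + 1`, in the absorbed
form used in the proof of Prop. 1.3): at a positive definite point `x` of metric components with
`Ric + Hess f = ½ G` on `V`, where `0 ≤ S ≤ A` and `|∇f|² ≥ 768 (A + 1)`, GIVEN the two pointwise
inputs (i) `|∇f|² |Rm|² ≤ 16 |∇f|² |Ric|² + 64 |∇Ric|²` (Prop. 1.1) and (ii)
`Δ_f |Ric|² ≥ 2|∇Ric|² + 2|Ric|² − 4|Rm| |Ric|²` ((1.10)) — with `|∇Ric|² = Σ g^{kl}⟨∇_kRic, ∇_lRic⟩` in a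
basis `b` — one has `Δ_f u ≥ u²/(8√(A+1)) − 2¹⁷(A+1)³`, `Δ_f = Δ_G − ⟨∇f, ∇·⟩`.
[cite: MunteanuWang2015, Lemma 1.2 and Prop. 1.3 (proof)] -/
theorem IsMetricOn.mw_drift_normSqAt_ricAt_mul_profile (hG : IsMetricOn G V) (hx : x ∈ V)
    (hpos : ∀ v : E, v ≠ 0 → 0 < G x v v) {f : E → ℝ} (hf : ContDiffOn ℝ ∞ f V)
    (hsol : ∀ y ∈ V, ∀ v w, ricAt G y v w + hessAt G f y v w = (1 / 2 : ℝ) * G y v w)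
    {ι : Type*} [Fintype ι] (b : Basis ι ℝ E) {A : ℝ} (hA : 0 ≤ A)
    (hSA : scalAt G x ≤ A) (hS0 : 0 ≤ scalAt G x) (hq : 768 * (A + 1) ≤ gradSqAt G f x)
    (hP : gradSqAt G f x * rmNormSqAt G x ≤
      16 * gradSqAt G f x * normSqAt G x (ricAt G x)
        + 64 * ∑ k, ∑ l, ginv G b x k l *
            pairAt G x (cov₂At G (ricAt G) x (b k)) (cov₂At G (ricAt G) x (b l)))
    (hL : 2 * (∑ k, ∑ l, ginv G b x k l *
            pairAt G x (cov₂At G (ricAt G) x (b k)) (cov₂At G (ricAt G) x (b l)))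
        + 2 * normSqAt G x (ricAt G x)
        - 4 * Real.sqrt (rmNormSqAt G x) * normSqAt G x (ricAt G x) ≤
      lapAt G (fun y ↦ normSqAt G y (ricAt G y)) x
        - fderiv ℝ (fun y ↦ normSqAt G y (ricAt G y)) x (sharpAt G x (fderiv ℝ f x))) :
    (normSqAt G x (ricAt G x) * (scalAt G x + 1) ^ (-(1 / 2 : ℝ))) ^ 2 / (8 * Real.sqrt (A + 1))
        - 131072 * (A + 1) ^ 3 ≤
      lapAt G (fun y ↦ normSqAt G y (ricAt G y) * (scalAt G y + 1) ^ (-(1 / 2 : ℝ))) x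
        - fderiv ℝ (fun y ↦ normSqAt G y (ricAt G y) * (scalAt G y + 1) ^ (-(1 / 2 : ℝ))) x
            (sharpAt G x (fderiv ℝ f x)) := by
  -- ### names
  set Rc : E → ℝ := fun y ↦ normSqAt G y (ricAt G y) with hRcdef
  set Dc := ∑ k, ∑ l, ginv G b x k l *
    pairAt G x (cov₂At G (ricAt G) x (b k)) (cov₂At G (ricAt G) x (b l)) with hDcdef
  set W : E := sharpAt G x (fderiv ℝ f x) with hWdef
  have hsymV : ∀ y ∈ V, ∀ v w, ricAt G y v w = ricAt G y w v := fun y hy ↦ hG.ricAt_comm hy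
  have hR0 : 0 ≤ normSqAt G x (ricAt G x) := hG.normSqAt_nonneg_of_symm hx hpos (hsymV x hx)
  have hD0 : 0 ≤ Dc := hG.covNormSq_nonneg b hx hpos hG.contDiffOn_ricAt hsymV
  obtain ⟨e, he⟩ := exists_orthonormal_basis (hG.symm x hx) hpos
  have hM0 : 0 ≤ rmNormSqAt G x := hG.rmNormSqAt_nonneg e he hx
  have hσpos : 0 < scalAt G x + 1 := by linarith
  have hq0 : 0 < gradSqAt G f x := lt_of_lt_of_le (by positivity) hq
  -- ### the constant `c = σ^{-1/2}`
  set c : ℝ := (scalAt G x + 1) ^ (-(1 / 2 : ℝ)) with hcdef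
  have hc0 : 0 < c := Real.rpow_pos_of_pos hσpos _
  have hc2 : c ^ 2 * (scalAt G x + 1) = 1 := by
    have h1 : c ^ 2 = (scalAt G x + 1) ^ (-(1 : ℝ)) := by
      rw [sq, hcdef, ← Real.rpow_add hσpos]; norm_num
    rw [h1, Real.rpow_neg_one, inv_mul_cancel₀ hσpos.ne']
  -- ### regularity and the expansion
  have hRc2 : ContDiffAt ℝ 2 Rc x := (hG.contDiffAt_normSqAt_ricAt hx).of_le (by norm_cast)
  have hS2 : ContDiffAt ℝ 2 (scalAt G) x := (hG.contDiffAt_scalAt hx).of_le (by norm_cast)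
  have hφ : ContDiffAt ℝ 2 (fun s : ℝ ↦ (s + 1) ^ (-(1 / 2 : ℝ))) (scalAt G x) :=
    contDiffAt_profile _ hσpos
  have hexp := hG.lapAt_sub_fderiv_mul_comp hx hRc2 hS2 hφ W
  have hd1 : deriv (fun s : ℝ ↦ (s + 1) ^ (-(1 / 2 : ℝ))) (scalAt G x) =
      -(1 / 2) * (c / (scalAt G x + 1)) := by
    rw [deriv_profile _ hσpos, Real.rpow_sub_one hσpos.ne', hcdef]
  have hdd2 : deriv (deriv fun s : ℝ ↦ (s + 1) ^ (-(1 / 2 : ℝ))) (scalAt G x) =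
      3 / 4 * (c / (scalAt G x + 1) ^ 2) := by
    rw [deriv_deriv_profile _ hσpos, Real.rpow_sub hσpos, Real.rpow_two, hcdef]
    ring
  -- ### `Δ_f S = S − 2|Ric|²`
  have hΔS : lapAt G (scalAt G) x - fderiv ℝ (scalAt G) x W =
      scalAt G x - 2 * normSqAt G x (ricAt G x) := by
    have h := hG.lapAt_scalAt_of_soliton hx hf hsol
    rw [h]; ring
  -- ### the cross term `T = ⟨∇|Ric|², ∇S⟩` and `|∇S|²`
  set T : ℝ := fderiv ℝ Rc x (sharpAt G x (fderiv ℝ (scalAt G) x)) with hTdef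
  have hpos' : ∀ v : E, 0 ≤ G x v v := fun v ↦ by
    by_cases hv : v = 0
    · simp [hv]
    · exact (hpos v hv).le
  have hgS0 : 0 ≤ gradSqAt G (scalAt G) x := by
    rw [gradSqAt_apply]
    exact apply_sharpAt_self_nonneg (hG.isInvertible x hx) hpos' _
  have hT2 : T ^ 2 ≤ 4 * normSqAt G x (ricAt G x) * Dc * gradSqAt G (scalAt G) x := by
    have h1 := hG.apply_sharpAt_sq_le hx hpos (fderiv ℝ Rc x) (fderiv ℝ (scalAt G) x)
    have hK := hG.gradSqAt_normSqAt_ricAt_le hx hpos b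
    rw [gradSqAt_apply] at hK
    have h2 := mul_le_mul_of_nonneg_right hK hgS0
    rw [gradSqAt_apply] at h2 ⊢
    exact h1.trans h2
  -- ### the real-variable lemmas
  have h4mR := mw_sqrt_term_bound (m := Real.sqrt (rmNormSqAt G x)) hR0 hD0 hq0 (by
    rw [Real.sq_sqrt hM0]; exact hP)
  have hdrift : lapAt G (fun y ↦ Rc y * (scalAt G y + 1) ^ (-(1 / 2 : ℝ))) x
        - fderiv ℝ (fun y ↦ Rc y * (scalAt G y + 1) ^ (-(1 / 2 : ℝ))) x W =
      c * (lapAt G Rc x - fderiv ℝ Rc x W)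
        + normSqAt G x (ricAt G x) * (-(1 / 2) * (c / (scalAt G x + 1))
            * (scalAt G x - 2 * normSqAt G x (ricAt G x))
          + 3 / 4 * (c / (scalAt G x + 1) ^ 2) * gradSqAt G (scalAt G) x)
        + 2 * (-(1 / 2) * (c / (scalAt G x + 1))) * T := by
    rw [hexp, hd1, hdd2, hΔS]
  have harith := mw_drift_arith hc0 hc2 hσpos (by linarith) hR0 hD0 hgS0 hq0
    (le_trans (by linarith) hq) hL h4mR hT2 hdrift
  obtain ⟨hk1, hk2⟩ := mw_constants (R := normSqAt G x (ricAt G x)) hc0 hc2 (by linarith) hA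
  linarith [harith, hk1, hk2]

end MetricCoord

end Literature.Geometry.Lorentzian

end
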